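import Literature.NumberTheory.Automorphic.UnramifiedOrbitSetNonsplit
import Literature.NumberTheory.Automorphic.UnramifiedOrbitalUnitFactor
import Literature.LinearAlgebra.Matrix.IntegralUnitaryConjugacyOfRegularElements
import HarnessLib

/-!
# The one-place unitary orbit lemma from integral unitary conjugacy, and `UnramifiedOrbitSetAE` MODULO norm surjectivity on the commutant
(Kottwitz, *Stable trace formula: elliptic singular terms* (1986), Prop. 7.1 ∕ Cor. 7.3 for the unramified unitary group `U(σ_w, J_w)(E_w)` and its
hyperspecial subgroup `U ∩ GL_N(𝒪_w)`; Rogawski (1990), §3.3 p. 21, §4.3 p. 44)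

Topic `NumberTheory/Automorphic`; namespace `Literature.NumberTheory.Automorphic.UnitaryGroup`; THEOREMS ONLY (no definition, no instance, no named
fact, no `sorry`).  Fourth repayment instalment of the named fact ★ `UnitaryGroup.UnramifiedOrbitSetAE` (★ `UnramifiedOrbitalUnitFactor`): the
«one-place dress» (F2-d) over the local field `E_w ⊃ 𝒪_w = w.adicCompletionIntegers E` of ★ `Literature.LinearAlgebra.Matrix.exists_integral_unitary_map_mul_of_conj`
(F2-b: the unitary upgrade of the `GL_N` orbit lemma ★ `IntegralConjugacyOfRegularElements`, MODULO norm surjectivity `hnorm` on the commutant of the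
integral lift), plugged into the hypothesis `hlocal` of ★ `UnramifiedOrbitSetNonsplit.eventually_orbitSet_cmDatum_of_local`.  What remains of the
named fact after this file is EXACTLY the norm equation on the commutant order `𝒪_w[γ̃]` at the unramified inert places (hypothesis `hN` below, the
headline shape of the companion F2-c `IntegralUnitaryConjugacyComplete`):

* §1 `orbitSet_unitaryGroupOfForm_of_hnorm` — at a non-split place `w ∣ v` (`c • w = w`) with `J_w ∈ GL_N(𝒪_w)`: for `γ_w ∈ U(σ_w, J_w)(E_w) ∩ GL_N(𝒪_w)`
  whose characteristic polynomial has an integral model separable modulo `𝔪_w`, IF the norm equation `τ(c) c = b` is solvable in the commutant of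
  the integral lift `γ̃` for every `τ`-fixed invertible `b` there (`τ X = J̃⁻¹ ᵗ(σ X) J̃`; hypothesis `hN`, quantified over every integral involution `σO`
  compatible with `σ_w` and every integral hermitian lift `J̃` of `J_w`), THEN
  `∀ y ∈ U(σ_w, J_w)(E_w), y γ_w y⁻¹ ∈ GL_N(𝒪_w) → y ∈ (U ∩ GL_N(𝒪_w)) · Z_U(γ_w)`.  Plumbing: `σO` = restriction of ★ `galAdicCompletionMap c hw` to
  `𝒪_w` (★ `galAdicCompletionMap_mem_adicCompletionIntegers_iff`), an involution (★ `galAdicCompletionMap_galAdicCompletionMap_of_smul_eq`); the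
  integral lift `J̃` of `J_w` is `σO`-hermitian (★ `placeForm_hermitian_of_smul_eq`); lifts through ★ `mem_range_map_adicCompletionIntegers_iff_mem_glInt`;
  unitarity descends ∕ ascends along `𝒪_w ↪ E_w` (★ `formUnitary_of_formUnitary_map` ∕ `formUnitary_map_of_formUnitary`).
* §2 **`unramifiedOrbitSetAE_of_hnorm (hH) (hHd) (hN) : UnramifiedOrbitSetAE L N H`** — for hermitian `H` with `det H ≠ 0`, the named fact follows from
  the norm-surjectivity hypothesis `hN` at the unramified non-split places (★ `eventually_orbitSet_cmDatum_of_local` with `hlocal` := §1).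

## References
* R. E. Kottwitz, *Stable trace formula: elliptic singular terms*, Math. Ann. 275 (1986), §7, Prop. 7.1, Cor. 7.3 [Kottwitz1986].
* J. D. Rogawski, *Automorphic Representations of Unitary Groups in Three Variables*, Ann. of Math. Stud. 123 (1990), §3.3 p. 21, §4.3 p. 44 (print)
  [Rogawski1990].
* R. Jacobowitz, *Hermitian forms over local fields*, Amer. J. Math. 84 (1962), §2 [Jacobowitz1962].
-/

set_option autoImplicit false

noncomputable section

open NumberField IsDedekindDomain Filter Polynomial
open scoped Matrix Pointwise

namespace Literature.NumberTheory.Automorphic.UnitaryGroup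

/-! ## §1 The one-place unitary orbit lemma, modulo norm surjectivity on the commutant of the integral lift -/

section OnePlace

variable {F E : Type} [Field F] [NumberField F] [Field E] [NumberField E] [Algebra F E]
  (c : E ≃ₐ[F] E) (N : ℕ) (J : Matrix (Fin N) (Fin N) E)

variable [Algebra.IsQuadraticExtension F E] {v : HeightOneSpectrum (𝓞 F)}

/-- **Kottwitz's orbit lemma in the one-place unitary group `U(σ_w, J_w)(E_w)`, modulo norm surjectivity on the commutant.**  Let `w ∣ v` be
non-split (`c • w = w`), `J` `c`-hermitian with `J_w ∈ GL_N(𝒪_w)`, and `γ_w ∈ U(σ_w, J_w)(E_w)` integral (`∈ GL_N(𝒪_w)`) with an integral model of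
its characteristic polynomial separable modulo `𝔪_w`.  ASSUME `hN`: for every ring involution `σO` of `𝒪_w` restricting `σ_w`, every `σO`-hermitian
invertible integral `J̃` lifting `J_w` and every `J̃`-unitary integral `γ̃` with `p_γ̃` separable modulo `𝔪_w`, the norm equation
`J̃⁻¹ ᵗ(σO c) J̃ · c = b` is solvable in the commutant of `γ̃` for every `τ`-fixed invertible `b` commuting with `γ̃` (the headline of the companion
`IntegralUnitaryConjugacyComplete`).  THEN every `y ∈ U(σ_w, J_w)(E_w)` with `y γ_w y⁻¹ ∈ GL_N(𝒪_w)` lies in `(U ∩ GL_N(𝒪_w)) · Z_U(γ_w)`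
(★ `exists_integral_unitary_map_mul_of_conj` along `𝒪_w ↪ E_w`). [cite: Kottwitz1986, Prop. 7.1] [cite: Rogawski1990, §3.3 p. 21] -/
theorem orbitSet_unitaryGroupOfForm_of_hnorm (hc : c ≠ 1) (hJh : (J.map c)ᵀ = J) (w : PlacesOver E v) (hw : c • w.1 = w.1)
    (hJw : IsUnit (placeForm J w.1)) (hJi : hJw.unit ∈ glInt N (w.1.adicCompletion E))
    (hN : ∀ σO : w.1.adicCompletionIntegers E →+* w.1.adicCompletionIntegers E,
      (∀ x : w.1.adicCompletionIntegers E, ((σO x : w.1.adicCompletionIntegers E) : w.1.adicCompletion E) =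
        galAdicCompletionMap (L := E) c hw x) →
      ∀ Jt : Matrix (Fin N) (Fin N) (w.1.adicCompletionIntegers E), Jt.map (w.1.adicCompletionIntegers E).subtype = placeForm J w.1 →
        (Jt.map σO)ᵀ = Jt → IsUnit Jt.det →
      ∀ γt : Matrix (Fin N) (Fin N) (w.1.adicCompletionIntegers E), (γt.map σO)ᵀ * Jt * γt = Jt →
        (γt.charpoly.map (IsLocalRing.residue (w.1.adicCompletionIntegers E))).Separable →
      ∀ b : Matrix (Fin N) (Fin N) (w.1.adicCompletionIntegers E), Commute γt b → IsUnit b.det → Jt⁻¹ * (b.map σO)ᵀ * Jt = b →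
        ∃ c' : Matrix (Fin N) (Fin N) (w.1.adicCompletionIntegers E), Commute γt c' ∧ Jt⁻¹ * (c'.map σO)ᵀ * Jt * c' = b)
    (γw : unitaryGroupOfForm (galAdicCompletionMap (L := E) c hw) (placeForm J w.1))
    (hγint : (γw : GL (Fin N) (w.1.adicCompletion E)) ∈ glInt N (w.1.adicCompletion E))
    (hsep : ∃ q : (w.1.adicCompletionIntegers E)[X],
      q.map (w.1.adicCompletionIntegers E).subtype =
          (((γw : GL (Fin N) (w.1.adicCompletion E)) : Matrix (Fin N) (Fin N) (w.1.adicCompletion E))).charpoly ∧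
        (q.map (IsLocalRing.residue (w.1.adicCompletionIntegers E))).Separable) :
    ∀ y : unitaryGroupOfForm (galAdicCompletionMap (L := E) c hw) (placeForm J w.1),
      ((y * γw * y⁻¹ : unitaryGroupOfForm (galAdicCompletionMap (L := E) c hw) (placeForm J w.1)) :
          GL (Fin N) (w.1.adicCompletion E)) ∈ glInt N (w.1.adicCompletion E) →
        y ∈ ((glInt N (w.1.adicCompletion E)).subgroupOf (unitaryGroupOfForm (galAdicCompletionMap (L := E) c hw) (placeForm J w.1)) :
            Set (unitaryGroupOfForm (galAdicCompletionMap (L := E) c hw) (placeForm J w.1))) *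
          (Subgroup.centralizer ({γw} : Set (unitaryGroupOfForm (galAdicCompletionMap (L := E) c hw) (placeForm J w.1))) :
            Set (unitaryGroupOfForm (galAdicCompletionMap (L := E) c hw) (placeForm J w.1))) := by
  -- the local field, its valuation ring, the involution and its integral restriction
  obtain ⟨O, hO⟩ : ∃ O : ValuationSubring (w.1.adicCompletion E), O = w.1.adicCompletionIntegers E := ⟨_, rfl⟩
  subst hO
  have hfinj : Function.Injective (w.1.adicCompletionIntegers E).subtype := Subtype.val_injective
  let σO : w.1.adicCompletionIntegers E →+* w.1.adicCompletionIntegers E :=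
    (galAdicCompletionMap (L := E) c hw).restrict (w.1.adicCompletionIntegers E) (w.1.adicCompletionIntegers E)
      fun x hx => (galAdicCompletionMap_mem_adicCompletionIntegers_iff E c hw x).2 hx
  have hσO : ∀ x : w.1.adicCompletionIntegers E, ((σO x : w.1.adicCompletionIntegers E) : w.1.adicCompletion E) =
      galAdicCompletionMap (L := E) c hw x := fun _ => rfl
  have hfσ : ∀ x : w.1.adicCompletionIntegers E, (w.1.adicCompletionIntegers E).subtype (σO x) =
      galAdicCompletionMap (L := E) c hw ((w.1.adicCompletionIntegers E).subtype x) := fun _ => rfl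
  have hσσ : ∀ x, σO (σO x) = x := fun x => Subtype.ext (galAdicCompletionMap_galAdicCompletionMap_of_smul_eq c w hc hw x)
  have hcomp : (⇑(w.1.adicCompletionIntegers E).subtype ∘ ⇑σO) =
      ⇑(galAdicCompletionMap (L := E) c hw) ∘ ⇑(w.1.adicCompletionIntegers E).subtype := funext fun x => hσO x
  -- the integral lift `J̃` of `J_w`: hermitian, invertible
  obtain ⟨Ju, hJu⟩ := (mem_range_map_adicCompletionIntegers_iff_mem_glInt N w.1 _).2 hJi
  have hJtf : (Ju : Matrix (Fin N) (Fin N) (w.1.adicCompletionIntegers E)).map (w.1.adicCompletionIntegers E).subtype = placeForm J w.1 := by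
    have h := congrArg (fun g : GL (Fin N) (w.1.adicCompletion E) => (g : Matrix (Fin N) (Fin N) (w.1.adicCompletion E))) hJu
    rw [IsUnit.unit_spec] at h
    exact h
  have hJt : ((Ju : Matrix (Fin N) (Fin N) (w.1.adicCompletionIntegers E)).map σO)ᵀ = Ju := by
    apply Matrix.map_injective hfinj
    change (((Units.val Ju).map σO)ᵀ).map _ = (Units.val Ju).map _
    rw [Matrix.transpose_map, Matrix.map_map, hcomp, ← Matrix.map_map, hJtf]
    exact placeForm_hermitian_of_smul_eq c w J hJh hw
  have hJtdet : IsUnit (Ju : Matrix (Fin N) (Fin N) (w.1.adicCompletionIntegers E)).det :=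
    (Matrix.isUnit_iff_isUnit_det _).1 Ju.isUnit
  -- the integral lift `γ̃` of `γ_w`: unitary, separable reduction
  obtain ⟨γu, hγu⟩ := (mem_range_map_adicCompletionIntegers_iff_mem_glInt N w.1 _).2 hγint
  have hγtf : (γu : Matrix (Fin N) (Fin N) (w.1.adicCompletionIntegers E)).map (w.1.adicCompletionIntegers E).subtype =
      ((γw : GL (Fin N) (w.1.adicCompletion E)) : Matrix (Fin N) (Fin N) (w.1.adicCompletion E)) :=
    congrArg (fun g : GL (Fin N) (w.1.adicCompletion E) => (g : Matrix (Fin N) (Fin N) (w.1.adicCompletion E))) hγu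
  have hγtU : ((γu : Matrix (Fin N) (Fin N) (w.1.adicCompletionIntegers E)).map σO)ᵀ * Ju * γu = Ju := by
    apply Literature.LinearAlgebra.Matrix.formUnitary_of_formUnitary_map (w.1.adicCompletionIntegers E).subtype hfinj hfσ
    rw [hγtf, hJtf]
    exact γw.2
  obtain ⟨q, hq, hqsep⟩ := hsep
  have hchar : (γu : Matrix (Fin N) (Fin N) (w.1.adicCompletionIntegers E)).charpoly = q := by
    apply Polynomial.map_injective (w.1.adicCompletionIntegers E).subtype hfinj
    rw [hq, ← Matrix.charpoly_map, hγtf]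
  have hsep' : ((γu : Matrix (Fin N) (Fin N) (w.1.adicCompletionIntegers E)).charpoly.map
      (IsLocalRing.residue (w.1.adicCompletionIntegers E))).Separable := by rw [hchar]; exact hqsep
  have hnorm := hN σO hσO Ju hJtf hJt hJtdet γu hγtU hsep'
  -- the orbit: `y γ_w y⁻¹ = g̃′ ⊗ 1`
  intro y hy
  obtain ⟨gu, hgu⟩ := (mem_range_map_adicCompletionIntegers_iff_mem_glInt N w.1 _).2 hy
  have hydet : IsUnit ((y : GL (Fin N) (w.1.adicCompletion E)) : Matrix (Fin N) (Fin N) (w.1.adicCompletion E)).det :=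
    (Matrix.isUnit_iff_isUnit_det _).1 (y : GL (Fin N) (w.1.adicCompletion E)).isUnit
  have hyU : ((((y : GL (Fin N) (w.1.adicCompletion E)) : Matrix (Fin N) (Fin N) (w.1.adicCompletion E))).map
      (galAdicCompletionMap (L := E) c hw))ᵀ * (Ju : Matrix (Fin N) (Fin N) (w.1.adicCompletionIntegers E)).map (w.1.adicCompletionIntegers E).subtype *
      ((y : GL (Fin N) (w.1.adicCompletion E)) : Matrix (Fin N) (Fin N) (w.1.adicCompletion E)) =
      (Ju : Matrix (Fin N) (Fin N) (w.1.adicCompletionIntegers E)).map (w.1.adicCompletionIntegers E).subtype := by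
    rw [hJtf]; exact y.2
  have h : ((y : GL (Fin N) (w.1.adicCompletion E)) : Matrix (Fin N) (Fin N) (w.1.adicCompletion E)) *
      (γu : Matrix (Fin N) (Fin N) (w.1.adicCompletionIntegers E)).map (w.1.adicCompletionIntegers E).subtype =
      (gu : Matrix (Fin N) (Fin N) (w.1.adicCompletionIntegers E)).map (w.1.adicCompletionIntegers E).subtype *
        ((y : GL (Fin N) (w.1.adicCompletion E)) : Matrix (Fin N) (Fin N) (w.1.adicCompletion E)) := by
    have h1 : (y * γw * y⁻¹ : unitaryGroupOfForm (galAdicCompletionMap (L := E) c hw) (placeForm J w.1)) * y = y * γw := by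
      rw [inv_mul_cancel_right]
    have h2 := congrArg (fun u : unitaryGroupOfForm (galAdicCompletionMap (L := E) c hw) (placeForm J w.1) =>
      (((u : GL (Fin N) (w.1.adicCompletion E)) : Matrix (Fin N) (Fin N) (w.1.adicCompletion E)))) h1
    have h3 := congrArg (fun g : GL (Fin N) (w.1.adicCompletion E) => (g : Matrix (Fin N) (Fin N) (w.1.adicCompletion E))) hgu
    simp only [Subgroup.coe_mul, Units.val_mul] at h2
    rw [hγtf, ← h2]
    congr 1
    exact h3.symm
  obtain ⟨k, z, hk, hkU, hz, hzγ, hzU, hykz⟩ :=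
    Literature.LinearAlgebra.Matrix.exists_integral_unitary_map_mul_of_conj (w.1.adicCompletionIntegers E).subtype hfinj hfσ hσσ hJt hJtdet
      hγtU hsep' hnorm hydet hyU h
  -- package `k ⊗ 1` and `z` as elements of `U(σ_w, J_w)(E_w)`
  have hkf : IsUnit (k.map (w.1.adicCompletionIntegers E).subtype) :=
    (Matrix.isUnit_iff_isUnit_det _).2 (by rw [← RingHom.mapMatrix_apply, ← RingHom.map_det]; exact hk.map _)
  have hzu : IsUnit z := (Matrix.isUnit_iff_isUnit_det _).2 hz
  have hkmem : hkf.unit ∈ unitaryGroupOfForm (galAdicCompletionMap (L := E) c hw) (placeForm J w.1) := by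
    rw [mem_unitaryGroupOfForm_iff, IsUnit.unit_spec, ← hJtf]
    exact Literature.LinearAlgebra.Matrix.formUnitary_map_of_formUnitary (w.1.adicCompletionIntegers E).subtype hfσ hkU
  have hzmem : hzu.unit ∈ unitaryGroupOfForm (galAdicCompletionMap (L := E) c hw) (placeForm J w.1) := by
    rw [mem_unitaryGroupOfForm_iff, IsUnit.unit_spec, ← hJtf]
    exact hzU
  refine Set.mem_mul.2 ⟨⟨hkf.unit, hkmem⟩, ?_, ⟨hzu.unit, hzmem⟩, ?_, ?_⟩
  · -- `k ⊗ 1 ∈ GL_N(𝒪_w)`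
    rw [SetLike.mem_coe, Subgroup.mem_subgroupOf]
    change hkf.unit ∈ glInt N (w.1.adicCompletion E)
    refine (mem_range_map_adicCompletionIntegers_iff_mem_glInt N w.1 _).1 ⟨((Matrix.isUnit_iff_isUnit_det k).2 hk).unit, Units.ext ?_⟩
    rw [IsUnit.unit_spec]
    change ((((Matrix.isUnit_iff_isUnit_det k).2 hk).unit : Matrix (Fin N) (Fin N) (w.1.adicCompletionIntegers E))).map _ = _
    rw [IsUnit.unit_spec]
  · -- `z` centralises `γ_w`
    rw [SetLike.mem_coe, Subgroup.mem_centralizer_singleton_iff]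
    refine Subtype.ext (Units.ext ?_)
    change z * ((γw : GL (Fin N) (w.1.adicCompletion E)) : Matrix (Fin N) (Fin N) (w.1.adicCompletion E)) =
      ((γw : GL (Fin N) (w.1.adicCompletion E)) : Matrix (Fin N) (Fin N) (w.1.adicCompletion E)) * z
    rw [← hγtf]
    exact hzγ
  · -- `y = (k ⊗ 1) z`
    refine Subtype.ext (Units.ext ?_)
    change k.map (w.1.adicCompletionIntegers E).subtype * z = ((y : GL (Fin N) (w.1.adicCompletion E)) : Matrix (Fin N) (Fin N) (w.1.adicCompletion E))
    exact hykz.symm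

end OnePlace

/-! ## §2 `UnramifiedOrbitSetAE L N H` from norm surjectivity at the unramified inert places -/

section CM

variable (L : Type) [Field L] [NumberField L] [IsCMField L] (N : ℕ) (H : Matrix (Fin N) (Fin N) L)

/-- **The named fact from the norm equation on the commutant orders.**  For `H` hermitian with `det H ≠ 0`: if at every finite place `v` of `L⁺`
unramified and NON-split in `L` (`c̄ • w = w`), for every ring involution `σO` of `𝒪_w` restricting the conjugation `σ_w`, every `σO`-hermitian
invertible integral `J̃` lifting `H_w`, and every `J̃`-unitary integral `γ̃` with separable reduction, the norm equation `J̃⁻¹ ᵗ(σO c) J̃ · c = b` is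
solvable in the commutant of `γ̃` for every adjoint-fixed invertible `b` there (hypothesis `hN` — the content of [Kottwitz1986, Prop. 7.1] beyond
`GL_N`: «units of the unramified commutant order are norms»), THEN `UnramifiedOrbitSetAE L N H` holds (★ `eventually_orbitSet_cmDatum_of_local`
with its one-place hypothesis supplied by §1). [cite: Kottwitz1986, Prop. 7.1; Cor. 7.3] [cite: Rogawski1990, §3.3 p. 21; §4.3 p. 44] -/
theorem unramifiedOrbitSetAE_of_hnorm (hH : (H.map (cmConjRingHom L))ᵀ = H) (hHd : H.det ≠ 0)
    (hN : ∀ (v : HeightOneSpectrum (𝓞 ↥(maximalRealSubfield L))) (w : PlacesOver L v) (hw : IsCMField.complexConj L • w.1 = w.1),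
      Algebra.IsUnramifiedIn (𝓞 L) v.asIdeal →
      ∀ σO : w.1.adicCompletionIntegers L →+* w.1.adicCompletionIntegers L,
        (∀ x : w.1.adicCompletionIntegers L, ((σO x : w.1.adicCompletionIntegers L) : w.1.adicCompletion L) =
          galAdicCompletionMap (L := L) (IsCMField.complexConj L) hw x) →
        ∀ Jt : Matrix (Fin N) (Fin N) (w.1.adicCompletionIntegers L), Jt.map (w.1.adicCompletionIntegers L).subtype = placeForm H w.1 →
          (Jt.map σO)ᵀ = Jt → IsUnit Jt.det →
        ∀ γt : Matrix (Fin N) (Fin N) (w.1.adicCompletionIntegers L), (γt.map σO)ᵀ * Jt * γt = Jt →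
          (γt.charpoly.map (IsLocalRing.residue (w.1.adicCompletionIntegers L))).Separable →
        ∀ b : Matrix (Fin N) (Fin N) (w.1.adicCompletionIntegers L), Commute γt b → IsUnit b.det → Jt⁻¹ * (b.map σO)ᵀ * Jt = b →
          ∃ c' : Matrix (Fin N) (Fin N) (w.1.adicCompletionIntegers L), Commute γt c' ∧ Jt⁻¹ * (c'.map σO)ᵀ * Jt * c' = b) :
    UnramifiedOrbitSetAE L N H := by
  intro γ hγ
  exact eventually_orbitSet_cmDatum_of_local L N H hH hHd γ hγ fun v w hw hv hJi γw hγint hsep =>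
    orbitSet_unitaryGroupOfForm_of_hnorm (IsCMField.complexConj L) N H (IsCMField.complexConj_ne_one L) hH w hw _ hJi
      (hN v w hw hv) γw hγint hsep

end CM

end Literature.NumberTheory.Automorphic.UnitaryGroup

end
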